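import Summits.Ventures.Crystal3D.Theorems.StickyWulffConstantGenericWallFloorBarlowLineCount
import Summits.Ventures.Crystal3D.Theorems.StickyWulffConstantGenericWallFloorBarlowFamiliesCountApart
import HarnessLib

/-!
# F4 (zig|zig corner) in lane T's format with explicit margin, under `FramesApart` (option (C)): `barlow_lineCount_le_payers_apart`
# (crux `GenericWallFloor`, stmt-Ventures-19480, line `WallLedgerG`; lane T's stubs at OffR := `FramesApart`, cf-p1 DECISION (xxxvii⁵))

HONEST FRAMING. Venture `Summits/Ventures/Crystal3D` (cell `crystal3d-full`), helper `--supports` the crux `GenericWallFloor`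
(stmt-Ventures-19480) of `route-Ventures-StickyWulffConstant`, registered line `WallLedgerG`, open stub `stub_twoSlabAdhesion`.
Rung credit only; F-C1 not moved; NOT the stub.  Inputs BY NAME: E1 (`ExactOnly`), `DoubleStarCoaxialAt` / `CapPairCoaxial`
(from `StarPairFar`).

Verbatim `barlow_lineCount_le_payers_explicit` (`…BarlowLineCountExplicit`) with the positional OFF-REGISTRY hypotheses
(`hoff₁`, `hoff₂`, `hdisjR`: reach sets) replaced by the translation-free `hapart₁`, `hapart₂`, `hsep` (clauses (i), (ii), (iii) of
`FramesApart` for the two zig corner frame sets `chainFrames e₃ L₁ v₁`, `chainFrames (−e₃) L₂ v₂`), the count being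
`barlowFamilies_card_le_payers_apart` (`…BarlowFamiliesCountApart`).  Conclusion unchanged:
`∃ T₁ T₂ ⊇ {lines with a vertex in the window band at lateral ≤ ρ − m}, #T₁ + #T₂ ≤ Σ_PAY(12−deg)`, `m = 3 + (8/3)(h+4R₀) + 3/min δ₁ δ₂`.
* **`barlow_lineCount_le_payers_apart`**.
WHAT THIS IS NOT: not lane T's `hlines` (orientation / up-presentation glue: `…BarlowOrientedGlueApart`); F-C1 not moved.
-/

noncomputable section

namespace Summit.Ventures.Crystal3D.Theorems

open Finset
open Literature.MathematicalPhysics.StatisticalMechanics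
open Summit.Ventures.Crystal3D.Cruxes.TextureLiminf.TexShadow (stacking)
open scoped InnerProductSpace

variable {X : Finset (EuclideanSpace ℝ (Fin 3))}

set_option maxHeartbeats 400000 in
open scoped Classical in
/-- **F4 in lane T's format, explicit margin.**  See the module docstring. -/
theorem barlow_lineCount_le_payers_apart (hX : ∀ p ∈ X, ∀ q ∈ X, p ≠ q → 1 ≤ dist p q)
    {sE : EuclideanSpace ℝ (Fin 3)} (hsE : sE ∈ fccSlots) (hcert : ExactOnly 0 (fccSlots.filter fun w => 0 < ⟪w, sE⟫_ℝ))
    (hDS : ∀ F₁ F₂ : EuclideanSpace ℝ (Fin 3) ≃ₗᵢ[ℝ] EuclideanSpace ℝ (Fin 3), DoubleStarCoaxialAt F₁ F₂) (hCP : CapPairCoaxial)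
    -- the cell
    {σ₁ σ₂ : ℤ → ℤ} (hσ₁ : IsHaggSeq σ₁) (hσ₂ : IsHaggSeq σ₂)
    (L₁ L₂ : EuclideanSpace ℝ (Fin 3) ≃ₗᵢ[ℝ] EuclideanSpace ℝ (Fin 3)) (s₀ s₂ : EuclideanSpace ℝ (Fin 3))
    (R₀ h ρ : ℝ) (hR₀ : 6 ≤ R₀) (hh : 0 ≤ h) (hρ : 1 ≤ ρ) (P₁ P₂ : Finset (EuclideanSpace ℝ (Fin 3))) (hP₁X : P₁ ⊆ X) (hP₂X : P₂ ⊆ X)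
    (hcell : ∀ p ∈ X, -(2 * R₀) ≤ p 2 ∧ p 2 ≤ h + 2 * R₀ ∧ p 0 ^ 2 + p 1 ^ 2 ≤ ρ ^ 2)
    (hP₁ : ∀ p, p ∈ P₁ ↔ (p ∈ stacking L₁ s₀ σ₁ ∧ -(2 * R₀) ≤ p 2 ∧ p 2 ≤ -R₀ ∧ p 0 ^ 2 + p 1 ^ 2 ≤ ρ ^ 2))
    (hP₂ : ∀ p, p ∈ P₂ ↔ (p ∈ stacking L₂ s₂ σ₂ ∧ h + R₀ ≤ p 2 ∧ p 2 ≤ h + 2 * R₀ ∧ p 0 ^ 2 + p 1 ^ 2 ≤ ρ ^ 2))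
    -- bottom walk data (vertical e₃)
    (v₁ : EuclideanSpace ℝ (Fin 3)) (canon₁ : ℤ → EuclideanSpace ℝ (Fin 3) → EuclideanSpace ℝ (Fin 3) × List WalkEntry)
    (ms₁ : ℤ → EuclideanSpace ℝ (Fin 3))
    (hv₁ : v₁ ∈ fccSlots) (hv₁2 : v₁ 2 = Real.sqrt (2 / 3))
    (hsteep₁ : Real.sqrt 2 / 2 ≤ ⟪L₁ v₁, EuclideanSpace.single (2 : Fin 3) (1 : ℝ)⟫_ℝ)
    (hcanon₁₁ : ∀ m t, σ₁ (m - 1) = 1 → canon₁ m t = (t, [⟨L₁, v₁, 0⟩]))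
    (hcanon₁₂ : ∀ m t, σ₁ (m - 1) = -1 → canon₁ m t =
      (t, [⟨twinFrame L₁ (L₁ (EuclideanSpace.single (2 : Fin 3) (1 : ℝ))),
            bestCapper (twinFrame L₁ (L₁ (EuclideanSpace.single (2 : Fin 3) (1 : ℝ)))) (L₁ (EuclideanSpace.single (2 : Fin 3) (1 : ℝ)))
              (EuclideanSpace.single (2 : Fin 3) (1 : ℝ)),
            L₁ (EuclideanSpace.single (2 : Fin 3) (1 : ℝ))⟩, ⟨L₁, v₁, 0⟩]))
    (hms₁₁ : ∀ m, σ₁ m = 1 → ms₁ m = v₁)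
    (hms₁₂ : ∀ m, σ₁ m = -1 → ms₁ m =
      basalMirror (bestCapper (twinFrame L₁ (L₁ (EuclideanSpace.single (2 : Fin 3) (1 : ℝ)))) (L₁ (EuclideanSpace.single (2 : Fin 3) (1 : ℝ)))
        (EuclideanSpace.single (2 : Fin 3) (1 : ℝ))))
    {δ₁ : ℝ} (hδ₁0 : 0 < δ₁) (hδ₁ : ∀ m, δ₁ ≤ ⟪L₁ (ms₁ m), EuclideanSpace.single (2 : Fin 3) (1 : ℝ)⟫_ℝ)
    -- top walk data (vertical −e₃)
    (v₂ : EuclideanSpace ℝ (Fin 3)) (canon₂ : ℤ → EuclideanSpace ℝ (Fin 3) → EuclideanSpace ℝ (Fin 3) × List WalkEntry)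
    (ms₂ : ℤ → EuclideanSpace ℝ (Fin 3))
    (hv₂ : v₂ ∈ fccSlots) (hv₂2 : v₂ 2 = Real.sqrt (2 / 3))
    (hsteep₂ : Real.sqrt 2 / 2 ≤ ⟪L₂ v₂, -EuclideanSpace.single (2 : Fin 3) (1 : ℝ)⟫_ℝ)
    (hcanon₂₁ : ∀ m t, σ₂ (m - 1) = 1 → canon₂ m t = (t, [⟨L₂, v₂, 0⟩]))
    (hcanon₂₂ : ∀ m t, σ₂ (m - 1) = -1 → canon₂ m t =
      (t, [⟨twinFrame L₂ (L₂ (EuclideanSpace.single (2 : Fin 3) (1 : ℝ))),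
            bestCapper (twinFrame L₂ (L₂ (EuclideanSpace.single (2 : Fin 3) (1 : ℝ)))) (L₂ (EuclideanSpace.single (2 : Fin 3) (1 : ℝ)))
              (-EuclideanSpace.single (2 : Fin 3) (1 : ℝ)),
            L₂ (EuclideanSpace.single (2 : Fin 3) (1 : ℝ))⟩, ⟨L₂, v₂, 0⟩]))
    (hms₂₁ : ∀ m, σ₂ m = 1 → ms₂ m = v₂)
    (hms₂₂ : ∀ m, σ₂ m = -1 → ms₂ m =
      basalMirror (bestCapper (twinFrame L₂ (L₂ (EuclideanSpace.single (2 : Fin 3) (1 : ℝ)))) (L₂ (EuclideanSpace.single (2 : Fin 3) (1 : ℝ)))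
        (-EuclideanSpace.single (2 : Fin 3) (1 : ℝ))))
    {δ₂ : ℝ} (hδ₂0 : 0 < δ₂) (hδ₂ : ∀ m, δ₂ ≤ ⟪L₂ (ms₂ m), -EuclideanSpace.single (2 : Fin 3) (1 : ℝ)⟫_ℝ)
    -- frames apart (clauses (i), (ii), (iii) of `FramesApart`)
    (hapart₁ : ∀ F ∈ chainFrames (EuclideanSpace.single (2 : Fin 3) (1 : ℝ)) L₁ v₁,
      F '' fccStacking 1 (Real.sqrt (2 / 3)) ≠ L₂ '' fccStacking 1 (Real.sqrt (2 / 3)) ∧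
      F '' fccStacking 1 (Real.sqrt (2 / 3)) ≠
        (twinFrame L₂ (L₂ (EuclideanSpace.single (2 : Fin 3) (1 : ℝ)))) '' fccStacking 1 (Real.sqrt (2 / 3)))
    (hapart₂ : ∀ F ∈ chainFrames (-EuclideanSpace.single (2 : Fin 3) (1 : ℝ)) L₂ v₂,
      F '' fccStacking 1 (Real.sqrt (2 / 3)) ≠ L₁ '' fccStacking 1 (Real.sqrt (2 / 3)) ∧
      F '' fccStacking 1 (Real.sqrt (2 / 3)) ≠
        (twinFrame L₁ (L₁ (EuclideanSpace.single (2 : Fin 3) (1 : ℝ)))) '' fccStacking 1 (Real.sqrt (2 / 3)))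
    (hsep : ∀ F₁ ∈ chainFrames (EuclideanSpace.single (2 : Fin 3) (1 : ℝ)) L₁ v₁,
      ∀ F₂ ∈ chainFrames (-EuclideanSpace.single (2 : Fin 3) (1 : ℝ)) L₂ v₂,
      ¬ ∃ (L : EuclideanSpace ℝ (Fin 3) ≃ₗᵢ[ℝ] EuclideanSpace ℝ (Fin 3)) (t₁ t₂ : EuclideanSpace ℝ (Fin 3)) (σ σ' : ℤ → ℤ),
        IsHaggSeq σ ∧ IsHaggSeq σ' ∧
        F₁ '' fccStacking 1 (Real.sqrt (2 / 3)) ⊆ (fun p => L p + t₁) '' barlowStacking 1 (Real.sqrt (2 / 3)) σ ∧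
        F₂ '' fccStacking 1 (Real.sqrt (2 / 3)) ⊆ (fun p => L p + t₂) '' barlowStacking 1 (Real.sqrt (2 / 3)) σ')
    -- the two zigzag polylines (lane T's `zigVertexS step` with `step = ms ∘ zigSlab`, axisSign = +1)
    (vertex₁ vertex₂ : ℤ → EuclideanSpace ℝ (Fin 3))
    (hsucc₁ : ∀ k, vertex₁ (k + 1) = vertex₁ k + ms₁ k) (hlayer₁ : ∀ k, vertex₁ k ∈ barlowLayer 1 (Real.sqrt (2 / 3)) σ₁ k)
    (hsucc₂ : ∀ k, vertex₂ (k + 1) = vertex₂ k + ms₂ k) (hlayer₂ : ∀ k, vertex₂ k ∈ barlowLayer 1 (Real.sqrt (2 / 3)) σ₂ k) :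
    ∃ (T₁ T₂ : Finset (Fin 2 → ℤ)),
      (∀ t : Fin 2 → ℤ, (∃ k : ℤ,
        -R₀ - 4 ≤ (L₁ (vertex₁ k + ((t 0 : ℝ) • triangularVec₁ 1 + (t 1 : ℝ) • triangularVec₂ 1)) + s₀) 2 ∧
        (L₁ (vertex₁ k + ((t 0 : ℝ) • triangularVec₁ 1 + (t 1 : ℝ) • triangularVec₂ 1)) + s₀) 2 ≤ -R₀ - 3 ∧
        Real.sqrt ((L₁ (vertex₁ k + ((t 0 : ℝ) • triangularVec₁ 1 + (t 1 : ℝ) • triangularVec₂ 1)) + s₀) 0 ^ 2 +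
          (L₁ (vertex₁ k + ((t 0 : ℝ) • triangularVec₁ 1 + (t 1 : ℝ) • triangularVec₂ 1)) + s₀) 1 ^ 2) ≤
          ρ - (3 + 8 / 3 * (h + 4 * R₀) + 3 / min δ₁ δ₂)) → t ∈ T₁) ∧
      (∀ t : Fin 2 → ℤ, (∃ k : ℤ,
        h + R₀ + 3 ≤ (L₂ (vertex₂ k + ((t 0 : ℝ) • triangularVec₁ 1 + (t 1 : ℝ) • triangularVec₂ 1)) + s₂) 2 ∧
        (L₂ (vertex₂ k + ((t 0 : ℝ) • triangularVec₁ 1 + (t 1 : ℝ) • triangularVec₂ 1)) + s₂) 2 ≤ h + R₀ + 4 ∧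
        Real.sqrt ((L₂ (vertex₂ k + ((t 0 : ℝ) • triangularVec₁ 1 + (t 1 : ℝ) • triangularVec₂ 1)) + s₂) 0 ^ 2 +
          (L₂ (vertex₂ k + ((t 0 : ℝ) • triangularVec₁ 1 + (t 1 : ℝ) • triangularVec₂ 1)) + s₂) 1 ^ 2) ≤
          ρ - (3 + 8 / 3 * (h + 4 * R₀) + 3 / min δ₁ δ₂)) → t ∈ T₂) ∧
      (T₁.card : ℝ) + T₂.card ≤
        ∑ y ∈ X.filter (fun y => (X.filter fun q => dist y q = 1).card ≠ 12 ∧ -R₀ - 2 ≤ y 2 ∧ y 2 ≤ h + R₀ + 2),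
          ((12 : ℝ) - ((X.filter fun q => dist y q = 1).card : ℝ)) := by
  classical
  set e₃ : EuclideanSpace ℝ (Fin 3) := EuclideanSpace.single (2 : Fin 3) (1 : ℝ) with he₃
  have he₃i : ∀ d : EuclideanSpace ℝ (Fin 3), ⟪d, e₃⟫_ℝ = d 2 := fun d => by rw [he₃, EuclideanSpace.inner_single_right]; simp
  have hzti : ∀ d : EuclideanSpace ℝ (Fin 3), ⟪d, -e₃⟫_ℝ = -d 2 := fun d => by rw [inner_neg_right, he₃i]
  set uv : (Fin 2 → ℤ) → EuclideanSpace ℝ (Fin 3) := fun t => (t 0 : ℝ) • triangularVec₁ 1 + (t 1 : ℝ) • triangularVec₂ 1 with huv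
  -- constants
  set δ : ℝ := min δ₁ δ₂ with hδ
  have hδ0 : 0 < δ := lt_min hδ₁0 hδ₂0
  have hδle₁ : δ ≤ δ₁ := min_le_left _ _
  have hδle₂ : δ ≤ δ₂ := min_le_right _ _
  have hinv₁ : 1 / δ₁ ≤ 1 / δ := one_div_le_one_div_of_le hδ0 hδle₁
  have hinv₂ : 1 / δ₂ ≤ 1 / δ := one_div_le_one_div_of_le hδ0 hδle₂
  have hinv0 : 0 ≤ 1 / δ := by positivity
  set m : ℝ := 3 + 8 / 3 * (h + 4 * R₀) + 3 / δ with hm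
  have hm0 : 0 ≤ m := by
    rw [hm]; have : 0 ≤ 3 / δ := by positivity
    nlinarith
  set ρw : ℝ := ρ - m with hρw
  set ρin : ℝ := ρw + 1 / δ with hρin
  have hρin₁ : ρin + 8 / 3 * (h + 4 * R₀) + ((-R₀ - 2 - (-R₀ - 4)) / δ₁ + 2) ≤ ρ - 1 := by
    have e : (-R₀ - 2 - (-R₀ - 4)) / δ₁ = 2 * (1 / δ₁) := by ring
    rw [e, hρin, hρw, hm]
    have : 3 / δ = 3 * (1 / δ) := by ring
    nlinarith
  have hρin₂ : ρin + 8 / 3 * (h + 4 * R₀) + ((-(h + R₀) - 2 - (-(h + R₀) - 4)) / δ₂ + 2) ≤ ρ - 1 := by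
    have e : (-(h + R₀) - 2 - (-(h + R₀) - 4)) / δ₂ = 2 * (1 / δ₂) := by ring
    rw [e, hρin, hρw, hm]
    have : 3 / δ = 3 * (1 / δ) := by ring
    nlinarith
  -- unit steps
  have hmsn₁ : ∀ k, ‖ms₁ k‖ = 1 := by
    intro k
    rcases hσ₁ k with hk | hk
    · rw [hms₁₁ k hk, norm_eq_one_of_mem_fccSlots hv₁]
    · rw [hms₁₂ k hk, LinearIsometryEquiv.norm_map, norm_eq_one_of_mem_fccSlots (bestCapper_nabla_slot L₁ e₃).1]
  have hmsn₂ : ∀ k, ‖ms₂ k‖ = 1 := by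
    intro k
    rcases hσ₂ k with hk | hk
    · rw [hms₂₁ k hk, norm_eq_one_of_mem_fccSlots hv₂]
    · rw [hms₂₂ k hk, LinearIsometryEquiv.norm_map, norm_eq_one_of_mem_fccSlots (bestCapper_nabla_slot L₂ (-e₃)).1]
  -- sites of the two stackings
  have hsite₁ : ∀ (k : ℤ) (t : Fin 2 → ℤ), vertex₁ k + uv t ∈ barlowStacking 1 (Real.sqrt (2 / 3)) σ₁ := by
    intro k t
    obtain ⟨x, y, hxy⟩ := hlayer₁ k
    rw [hxy, huv]; simp only
    rw [barlowPos_add_inplane]; exact barlowPos_mem _ _ _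
  have hsite₂ : ∀ (k : ℤ) (t : Fin 2 → ℤ), vertex₂ k + uv t ∈ barlowStacking 1 (Real.sqrt (2 / 3)) σ₂ := by
    intro k t
    obtain ⟨x, y, hxy⟩ := hlayer₂ k
    rw [hxy, huv]; simp only
    rw [barlowPos_add_inplane]; exact barlowPos_mem _ _ _
  -- the window balls and their line sets
  set W₁ : Finset (EuclideanSpace ℝ (Fin 3)) := P₁.filter fun q => -R₀ - 4 ≤ q 2 ∧ q 2 ≤ -R₀ - 3 ∧ Real.sqrt (q 0 ^ 2 + q 1 ^ 2) ≤ ρw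
    with hW₁
  set W₂ : Finset (EuclideanSpace ℝ (Fin 3)) := P₂.filter fun q => h + R₀ + 3 ≤ q 2 ∧ q 2 ≤ h + R₀ + 4 ∧ Real.sqrt (q 0 ^ 2 + q 1 ^ 2) ≤ ρw
    with hW₂
  have hW₁site : ∀ q ∈ W₁, ∃ k i j : ℤ, q = L₁ (barlowPos 1 (Real.sqrt (2 / 3)) σ₁ k i j) + s₀ := by
    intro q hq
    obtain ⟨hqP, -⟩ := Finset.mem_filter.1 hq
    obtain ⟨r, ⟨k, i, j, rfl⟩, hr⟩ := ((hP₁ q).1 hqP).1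
    exact ⟨k, i, j, hr.symm⟩
  have hW₂site : ∀ q ∈ W₂, ∃ k i j : ℤ, q = L₂ (barlowPos 1 (Real.sqrt (2 / 3)) σ₂ k i j) + s₂ := by
    intro q hq
    obtain ⟨hqP, -⟩ := Finset.mem_filter.1 hq
    obtain ⟨r, ⟨k, i, j, rfl⟩, hr⟩ := ((hP₂ q).1 hqP).1
    exact ⟨k, i, j, hr.symm⟩
  obtain ⟨Tl₁, hTl₁in, hTl₁out, -⟩ := lineSet_of_sites σ₁ L₁ s₀ vertex₁ hlayer₁ W₁ hW₁site
  obtain ⟨Tl₂, hTl₂in, hTl₂out, -⟩ := lineSet_of_sites σ₂ L₂ s₂ vertex₂ hlayer₂ W₂ hW₂site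
  -- the window families (lowest band vertices)
  have hwin₁ : ∀ t ∈ Tl₁, ∃ k : ℤ, (-R₀ - 4) ≤ ⟪L₁ (vertex₁ k + uv t) + s₀, e₃⟫_ℝ ∧ ⟪L₁ (vertex₁ k + uv t) + s₀, e₃⟫_ℝ ≤ (-R₀ - 4) + 1 ∧
      Real.sqrt ((L₁ (vertex₁ k + uv t) + s₀) 0 ^ 2 + (L₁ (vertex₁ k + uv t) + s₀) 1 ^ 2) ≤ ρw := by
    intro t ht
    obtain ⟨k, hk⟩ := hTl₁out t ht
    obtain ⟨-, h1, h2, h3⟩ := Finset.mem_filter.1 hk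
    exact ⟨k, by rw [he₃i]; exact h1, by rw [he₃i]; linarith, h3⟩
  have hwin₂ : ∀ t ∈ Tl₂, ∃ k : ℤ, (-(h + R₀) - 4) ≤ ⟪L₂ (vertex₂ k + uv t) + s₂, -e₃⟫_ℝ ∧ ⟪L₂ (vertex₂ k + uv t) + s₂, -e₃⟫_ℝ ≤ (-(h + R₀) - 4) + 1 ∧
      Real.sqrt ((L₂ (vertex₂ k + uv t) + s₂) 0 ^ 2 + (L₂ (vertex₂ k + uv t) + s₂) 1 ^ 2) ≤ ρw := by
    intro t ht
    obtain ⟨k, hk⟩ := hTl₂out t ht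
    obtain ⟨-, h1, h2, h3⟩ := Finset.mem_filter.1 hk
    exact ⟨k, by rw [hzti]; linarith, by rw [hzti]; linarith, h3⟩
  obtain ⟨mi₁, ai₁, bi₁, hfam₁⟩ := lineFamily_spec σ₁ L₁ s₀ e₃ ms₁ vertex₁ hδ₁0 hδ₁ hmsn₁ hsucc₁ hlayer₁ (-R₀ - 4) ρw Tl₁ hwin₁
  obtain ⟨mi₂, ai₂, bi₂, hfam₂⟩ := lineFamily_spec σ₂ L₂ s₂ (-e₃) ms₂ vertex₂ hδ₂0 hδ₂ hmsn₂ hsucc₂ hlayer₂ (-(h + R₀) - 4) ρw Tl₂ hwin₂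
  -- fuel
  set N : ℕ := ⌈2 / δ⌉₊ + ⌈8 * (h + 4 * R₀) / 3⌉₊ + 2 with hN
  have hN₁ : ⌈(-R₀ - 2 - (-R₀ - 4)) / δ₁⌉₊ + 1 ≤ N := by
    have e : (-R₀ - 2 - (-R₀ - 4)) / δ₁ = 2 / δ₁ := by ring
    rw [e, hN]
    have : ⌈2 / δ₁⌉₊ ≤ ⌈2 / δ⌉₊ := Nat.ceil_mono (by
      have : 2 / δ₁ = 2 * (1 / δ₁) := by ring
      have : 2 / δ = 2 * (1 / δ) := by ring
      nlinarith)
    omega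
  have hN₂ : ⌈(-(h + R₀) - 2 - (-(h + R₀) - 4)) / δ₂⌉₊ + 1 ≤ N := by
    have e : (-(h + R₀) - 2 - (-(h + R₀) - 4)) / δ₂ = 2 / δ₂ := by ring
    rw [e, hN]
    have : ⌈2 / δ₂⌉₊ ≤ ⌈2 / δ⌉₊ := Nat.ceil_mono (by
      have : 2 / δ₂ = 2 * (1 / δ₂) := by ring
      have : 2 / δ = 2 * (1 / δ) := by ring
      nlinarith)
    omega
  have hNfuel : 8 * (h + 4 * R₀) < 3 * (N : ℝ) := by
    rw [hN]; push_cast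
    have h1 := Nat.le_ceil (8 * (h + 4 * R₀) / 3)
    have h2 : (0 : ℝ) ≤ ⌈2 / δ⌉₊ := Nat.cast_nonneg _
    linarith
  -- the two-family count
  have hcount := barlowFamilies_card_le_payers_apart hX hsE hcert hDS hCP hσ₁ hσ₂ L₁ L₂ s₀ s₂ R₀ h ρ hR₀ hh hρ P₁ P₂ hP₁X hP₂X hcell hP₁ hP₂
    v₁ canon₁ ms₁ hv₁ hv₁2 hsteep₁ hcanon₁₁ hcanon₁₂ hms₁₁ hms₁₂ hδ₁0 hδ₁ v₂ canon₂ ms₂ hv₂ hv₂2 hsteep₂ hcanon₂₁ hcanon₂₂ hms₂₁ hms₂₂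
    hδ₂0 hδ₂ hapart₁ hapart₂ hsep (-R₀ - 4) (-(h + R₀) - 4) ρin (by linarith) (by linarith) (by linarith) (by linarith) hρin₁ hρin₂
    Tl₁ Tl₂ mi₁ ai₁ bi₁ mi₂ ai₂ bi₂
    (fun t ht => (hfam₁ t ht).2.1) (fun t ht => (hfam₁ t ht).2.2.2.1) (fun t ht t' ht' heq => (hfam₁ t ht).2.2.2.2.2 t' ht' heq)
    (fun t ht => by have := (hfam₁ t ht).2.2.2.2.1; rw [hρin]; linarith)
    (fun t ht => (hfam₂ t ht).2.1) (fun t ht => (hfam₂ t ht).2.2.2.1) (fun t ht t' ht' heq => (hfam₂ t ht).2.2.2.2.2 t' ht' heq)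
    (fun t ht => by have := (hfam₂ t ht).2.2.2.2.1; rw [hρin]; linarith)
    hN₁ hN₂ hNfuel
  refine ⟨Tl₁, Tl₂, fun t ht => ?_, fun t ht => ?_, hcount⟩
  · -- a window vertex at lateral ≤ ρ − m = ρw is a ball of W₁
    obtain ⟨k, h1', h2', h3'⟩ := ht
    have h1 : -R₀ - 4 ≤ (L₁ (vertex₁ k + uv t) + s₀) 2 := h1'
    have h2 : (L₁ (vertex₁ k + uv t) + s₀) 2 ≤ -R₀ - 3 := h2'
    have h3 : Real.sqrt ((L₁ (vertex₁ k + uv t) + s₀) 0 ^ 2 + (L₁ (vertex₁ k + uv t) + s₀) 1 ^ 2) ≤ ρ - m := h3'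
    have h0 : 0 ≤ (L₁ (vertex₁ k + uv t) + s₀) 0 ^ 2 + (L₁ (vertex₁ k + uv t) + s₀) 1 ^ 2 := by positivity
    have hs := Real.sqrt_nonneg ((L₁ (vertex₁ k + uv t) + s₀) 0 ^ 2 + (L₁ (vertex₁ k + uv t) + s₀) 1 ^ 2)
    have hle : Real.sqrt ((L₁ (vertex₁ k + uv t) + s₀) 0 ^ 2 + (L₁ (vertex₁ k + uv t) + s₀) 1 ^ 2) ≤ ρ := by linarith only [h3, hm0]
    have hlat2 : (L₁ (vertex₁ k + uv t) + s₀) 0 ^ 2 + (L₁ (vertex₁ k + uv t) + s₀) 1 ^ 2 ≤ ρ ^ 2 := by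
      have h7 := pow_le_pow_left₀ hs hle 2
      rwa [Real.sq_sqrt h0] at h7
    have hstk : L₁ (vertex₁ k + uv t) + s₀ ∈ stacking L₁ s₀ σ₁ := by
      unfold stacking; exact Set.mem_image_of_mem (fun r => L₁ r + s₀) (hsite₁ k t)
    have hqP : L₁ (vertex₁ k + uv t) + s₀ ∈ P₁ := (hP₁ _).2 ⟨hstk, by linarith only [h1, hR₀], by linarith only [h2], hlat2⟩
    have hqW : L₁ (vertex₁ k + uv t) + s₀ ∈ W₁ := by
      rw [hW₁, Finset.mem_filter]; exact ⟨hqP, h1, h2, by rw [hρw]; exact h3⟩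
    exact hTl₁in t ⟨k, hqW⟩
  · obtain ⟨k, h1', h2', h3'⟩ := ht
    have h1 : h + R₀ + 3 ≤ (L₂ (vertex₂ k + uv t) + s₂) 2 := h1'
    have h2 : (L₂ (vertex₂ k + uv t) + s₂) 2 ≤ h + R₀ + 4 := h2'
    have h3 : Real.sqrt ((L₂ (vertex₂ k + uv t) + s₂) 0 ^ 2 + (L₂ (vertex₂ k + uv t) + s₂) 1 ^ 2) ≤ ρ - m := h3'
    have h0 : 0 ≤ (L₂ (vertex₂ k + uv t) + s₂) 0 ^ 2 + (L₂ (vertex₂ k + uv t) + s₂) 1 ^ 2 := by positivity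
    have hs := Real.sqrt_nonneg ((L₂ (vertex₂ k + uv t) + s₂) 0 ^ 2 + (L₂ (vertex₂ k + uv t) + s₂) 1 ^ 2)
    have hle : Real.sqrt ((L₂ (vertex₂ k + uv t) + s₂) 0 ^ 2 + (L₂ (vertex₂ k + uv t) + s₂) 1 ^ 2) ≤ ρ := by linarith only [h3, hm0]
    have hlat2 : (L₂ (vertex₂ k + uv t) + s₂) 0 ^ 2 + (L₂ (vertex₂ k + uv t) + s₂) 1 ^ 2 ≤ ρ ^ 2 := by
      have h7 := pow_le_pow_left₀ hs hle 2
      rwa [Real.sq_sqrt h0] at h7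
    have hstk : L₂ (vertex₂ k + uv t) + s₂ ∈ stacking L₂ s₂ σ₂ := by
      unfold stacking; exact Set.mem_image_of_mem (fun r => L₂ r + s₂) (hsite₂ k t)
    have hqP : L₂ (vertex₂ k + uv t) + s₂ ∈ P₂ := (hP₂ _).2 ⟨hstk, by linarith only [h1], by linarith only [h2, hR₀], hlat2⟩
    have hqW : L₂ (vertex₂ k + uv t) + s₂ ∈ W₂ := by
      rw [hW₂, Finset.mem_filter]; exact ⟨hqP, h1, h2, by rw [hρw]; exact h3⟩
    exact hTl₂in t ⟨k, hqW⟩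

end Summit.Ventures.Crystal3D.Theorems

end
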